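import Summits.QuantumFields.BalabanUV.Beta.D1BFx.ChartDefectRowRestScales
import Summits.QuantumFields.BalabanUV.Beta.D1BFx.StraightPinLegSup
import Summits.QuantumFields.BalabanUV.Beta.D1BFx.SymMixedTableMass

/-!
# `BalabanUV.Beta.D1BFx.ChartDefectRowRestScalesFree` — road «BF-x», binder row D1, PART 24-hyb HEAD ON THE SCALES: **ROW (rest) ON THE SCALES WITH THE TABLE
# LETTER DISCHARGED — modulo the leg sup `hK₀ : ∀ m, Bdd (KInvStep 3 (Lc^m) 0) S₀` ONLY.**  `ChartDefectRowRestScales.row_rest_scales` (this lineage, g64) displayed the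
# table law `hMix : ∀ m, symMixAbs ρ_c(Lc^m) (Lc^m) ≤ Cmix·(Lc^m)³`; d1-leaf-04 g29's «SYMMIX-MASS» (5∕5) `SymMixedTableMass.symMixAbs_ctr_le` IS that law with
# `Cmix = 75000·4·10³ = 3·10⁸` at the road's centred root `ctr 4 n`.  One substitution: `C_rest* = (289·S₀·(3·10⁸)·(K*·e^{4θ}))·Σ'_x |x|₁² e^{−min (m₀∕8) (θ∕2)|x|₁}` —
# NO `m`, NO `Lc`, NO table letter.

HONEST DEPENDENCY (cell records, verbatim): «continuum YM on T⁴ ⇐ BetaPertH ∧ nine spine estimates (0/9 proved); BetaPertH ⇐ (D1) ∧ (D4) ∧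
CAP+tail; G-an2-4 gates asym, D1 and NE2/3/4.»  HONEST FRAMING (cell contract, verbatim): «discharging `BetaPertH` makes Bałaban's UV stability
UNCONDITIONAL — a real constructive-QFT result; it is NOT the continuum limit and NOT the Clay problem.»  THIS MODULE is [folklore] bookkeeping BY NAME over two
landed files (`row_rest_scales`, `symMixAbs_ctr_le`) and `push_cast`-arithmetic.  No `def`, no `def … : Prop`, nothing cited, 0 sorry, default heartbeats.
WHAT IT IS: the (rest) row of `ChartDefectHeadScales` (`hWrest` by `rfl`, `hArest ∕ hBrest` by `row_rest_scales_free`) priced DOWN TO THE LEG LETTER `S₀` with an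
m-independent constant — the first of an2 R-D1-g48 W-6 (3)'s two uniformities for THIS row, the table's n-law now a THEOREM of the tree (leaf-04's), not a letter.
WHAT IT IS NOT: the n-law of `S₀` (the (K)-wall's ∕ «G0-DECAY»'s modulo `hΓ` — NOT asserted); the HEAD (seven rows remain); NOT a binder; 0∕4 row-D1 binders
(hW ∕ hR ∕ D1Tel ∕ D1Rep); (K) NOT closed; (J1) ONE OPEN ROW; NOT D1, NEVER «G-an2-4 closed», NOT `BetaPertH`, NOT continuum, NOT Clay.

ABSOLUTE RULE (cell charter, verbatim): «No internally-minted statement may enter as a cited fact. Every hypothesis is either kernel-proved in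
this package or a verbatim quotation of a PUBLISHED theorem with page reference. The manuscript(s) under audit are NOT citable for their own
disputed steps — they are the thing under adjudication; programme-internal (2001/route/tribunal) claims are never citable.»

CONTENT.  §1 `symMixAbs_ctr4_le` (`symMixAbs (ctr 4 n) n ≤ 3·10⁸·n³`, `1 ≤ n` via `[NeZero n]` — leaf-04's `symMixAbs_ctr_le` at `d = 4`, `push_cast; ring`);
**`row_rest_scales_free`** = `row_rest_scales` with `hMix := fun m ↦ symMixAbs_ctr4_le (Lc^m)`, `Cmix := 300000000`;
§2 **`row_rest_scales_of_hΓ`** = `row_rest_scales_free` with `hK₀ := StraightPinLegSup.bdd_K₀_scales_of_hΓ hCΓ hδΓ hΓ` («K0-BDD-UNIFORM», this lineage): THE (rest) ROW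
ON THE SCALES MODULO THE ff LETTER `hΓ` ALONE (one `CΓ ≥ 0`, `δΓ ≥ 0` for all scales) — `S₀ := S₀* = CΓ + 2·C₄e^{κ′} + (2·c166Z 3)·e^{kappaZ 3}`.
Unit `b2b-balaban-gan24-formalise-leaf-05` (gen 64), G-an2-4 swarm leaf prover 05, road «BF-x» supplier, (rest) row lineage g62–g64; INTENT-2 (+A-1) «REST-ROW-SCALES-FREE» (journal).
Not in print; our bookkeeping.  No existing file touched.
-/

noncomputable section

open Literature.MathematicalPhysics.QuantumFieldTheory
open Literature.MathematicalPhysics.QuantumFieldTheory.Balaban1983to89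
open Literature.MathematicalPhysics.QuantumFieldTheory.Balaban1983to89.Beta
open B12Sec2to5 (l1)
open B12Beta (secondMoment)
open DecimatedMomentSummable (AbsMoment₂)
open B5Hk163Strip (kappa163)
open B5Hk163Decay (MG163)
open B4TorusKernel (periodConst)
open WilsonVertex2Sym (wsym22)
open WilsonBiStencil (wilsonW₂)
open StepJetData (wilsonA)
open ExpKernelCalculus (Site MKer Zl tadpole)
open AveragingContoursRooted (ctr)
open KernelWard (Bdd)
open OneStepResolventKernel (Fib)
open OneStepKernelFamily (KInvStep)
open SecondOrderResponse (mixOfK W2SymOfK vertex2OfK)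
open BalabanStepW2 (M2Of)
open Summit.QuantumFields.BalabanUV.Beta.SymAveragingHessianCounts (symVhSAt)
open Summit.QuantumFields.BalabanUV.Beta.SymAveragingMixedJetTables (symMixAbs)
open Summit.QuantumFields.BalabanUV.Beta.SymSecondOrderTablesAn1 (symVh₂SAn1 symTablesAn1S2)
open Summit.QuantumFields.BalabanUV.Beta.AxialDressingRooted (coDressKBmAt)
open Summit.QuantumFields.BalabanUV.Beta.GAN24.DirichletExhaustionDeltaZ (c166Z kappaZ)
open Summit.QuantumFields.BalabanUV.Beta.D1BFx.ChartDefectRowRestScales (row_rest_scales)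
open Summit.QuantumFields.BalabanUV.Beta.D1BFx.StraightPinLegSup (bdd_K₀_scales_of_hΓ legSupConst_nonneg)
open KKTFluctuationKernel (Gam)
open Summit.QuantumFields.BalabanUV.Beta.D1BFx.SymMixedTableMass (symMixAbs_ctr_le)

namespace Summit.QuantumFields.BalabanUV.Beta.D1BFx.ChartDefectRowRestScalesFree

/-- [folklore] **an1's mixed table at the road's centred root: `symMixAbs (ctr 4 n) n ≤ 3·10⁸·n³`** — d1-leaf-04 g29's `SymMixedTableMass.symMixAbs_ctr_le`
(`≤ 75000·d·((2d+2)·n)³`) at `d = 4`, the numeral multiplied out.  No value of the table asserted beyond that theorem. -/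
theorem symMixAbs_ctr4_le (n : ℕ) [NeZero n] : symMixAbs (ctr 4 n) n ≤ 300000000 * (n : ℝ) ^ 3 := by
  have h := symMixAbs_ctr_le (d := 4) (Nat.one_le_iff_ne_zero.2 (NeZero.ne n))
  calc symMixAbs (ctr 4 n) n ≤ 75000 * (4 : ℕ) * (((2 * 4 + 2) * n : ℕ) : ℝ) ^ 3 := h
    _ = 300000000 * (n : ℝ) ^ 3 := by push_cast; ring

/-- **ROW (rest) ON THE SCALES, TABLE LETTER DISCHARGED — `hArest` ∧ `hBrest` WITH `Crest` BOUND BEFORE `m`, MODULO `hK₀` ONLY** [our objects + folklore]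
(`hK₀ : ∀ m, Bdd (KInvStep 3 (Lc^m) 0) S₀`, `0 ≤ S₀`; `N`, `cΛ : ℕ → ℝ`, `0 < θ` free):
(i) `∀ m a e, AbsMoment₂ (z₀ ↦ ½·tadpole G₀ (W2SymOfK K₀ (Lc^m) S♭ M⁰ S₂⁰ M₂⁰ a 0 e z₀ − vertex2OfK K₀ (Lc^m) S₂⁰ a 0 e z₀))`;
(ii) `∀ m, |secondMoment (a e z₀ ↦ …) μ ν| ≤ (289·S₀·300000000·(K*·e^{4θ}))·Σ'_x |x|₁² e^{−min (m₀∕8) (θ∕2)|x|₁}`,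
`K* = 16·C₄e^{κ′}·((2·c166Z 3)·e^{kappaZ 3})·e^{m₀}·e^{m₀}·Zl 4 (m₀∕8)·Zl 4 (θ∕2)`, `m₀ = min (kappa163 4∕4) (kappaZ 3)` — neither `m` nor `Lc` on the right.
`ChartDefectRowRestScales.row_rest_scales` with `hMix := fun m ↦ symMixAbs_ctr4_le (Lc^m)`.  The kernel is `ChartDefectHeadScales`' pin `hWrest` VERBATIM
(`Wrest := fun m a e z₀ ↦` the literal, `hWrest := fun _ _ _ _ ↦ rfl`, `hArest := (row_rest_scales_free …).1`, `hBrest := (row_rest_scales_free …).2`).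
One of eight rows; NOT the HEAD, NOT a binder; asserts NO n-law of `S₀`. -/
theorem row_rest_scales_free {Lc : ℕ} [NeZero Lc] (N : ℕ) (cΛ : ℕ → ℝ) {S₀ : ℝ} (hS₀ : 0 ≤ S₀)
    (hK₀ : ∀ m : ℕ, Bdd (KInvStep (d := 3) (Lc ^ m) 0) S₀) {θ : ℝ} (hθ : 0 < θ) (μ ν : Fin 4) :
    (∀ (m : ℕ) (a e : Fin 4), AbsMoment₂ (fun z₀ : Site 4 => (1 / 2 : ℝ) * tadpole (coDressKBmAt (ctr 4 (Lc ^ m)) (Lc ^ m) (KInvStep (d := 3) (Lc ^ m) 0))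
        (W2SymOfK (KInvStep (d := 3) (Lc ^ m) 0) (Lc ^ m) (fun κ u => (((Lc ^ m : ℕ) : ℝ) ^ 4) • wilsonA 3 κ u + (-(((Lc ^ m : ℕ) : ℝ) ^ 8 / 2)) • symVhSAt (ctr 4 (Lc ^ m)) 3 (Lc ^ m) rfl κ u)
              ((symTablesAn1S2 3 (Lc ^ m) (cΛ m)).M 0) (fun κ u κ' u' => (((Lc ^ m : ℕ) : ℝ) ^ 8) • wilsonW₂ 3 ((8 * (N : ℝ) ^ 2)⁻¹ • wsym22 N) κ u κ' u' + (-(((Lc ^ m : ℕ) : ℝ) ^ 12 / 4)) • symVh₂SAn1 3 (Lc ^ m) κ u κ' u')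
              (M2Of 3 (Lc ^ m) (symTablesAn1S2 3 (Lc ^ m) (cΛ m)).mixFF 0) a 0 e z₀
          - vertex2OfK (KInvStep (d := 3) (Lc ^ m) 0) (Lc ^ m)
              (fun κ u κ' u' => (((Lc ^ m : ℕ) : ℝ) ^ 8) • wilsonW₂ 3 ((8 * (N : ℝ) ^ 2)⁻¹ • wsym22 N) κ u κ' u' + (-(((Lc ^ m : ℕ) : ℝ) ^ 12 / 4)) • symVh₂SAn1 3 (Lc ^ m) κ u κ' u') a 0 e z₀))) ∧
      ∀ m : ℕ, |secondMoment (fun (a e : Fin 4) (z₀ : Site 4) => (1 / 2 : ℝ) * tadpole (coDressKBmAt (ctr 4 (Lc ^ m)) (Lc ^ m) (KInvStep (d := 3) (Lc ^ m) 0))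
        (W2SymOfK (KInvStep (d := 3) (Lc ^ m) 0) (Lc ^ m) (fun κ u => (((Lc ^ m : ℕ) : ℝ) ^ 4) • wilsonA 3 κ u + (-(((Lc ^ m : ℕ) : ℝ) ^ 8 / 2)) • symVhSAt (ctr 4 (Lc ^ m)) 3 (Lc ^ m) rfl κ u)
              ((symTablesAn1S2 3 (Lc ^ m) (cΛ m)).M 0) (fun κ u κ' u' => (((Lc ^ m : ℕ) : ℝ) ^ 8) • wilsonW₂ 3 ((8 * (N : ℝ) ^ 2)⁻¹ • wsym22 N) κ u κ' u' + (-(((Lc ^ m : ℕ) : ℝ) ^ 12 / 4)) • symVh₂SAn1 3 (Lc ^ m) κ u κ' u')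
              (M2Of 3 (Lc ^ m) (symTablesAn1S2 3 (Lc ^ m) (cΛ m)).mixFF 0) a 0 e z₀
          - vertex2OfK (KInvStep (d := 3) (Lc ^ m) 0) (Lc ^ m)
              (fun κ u κ' u' => (((Lc ^ m : ℕ) : ℝ) ^ 8) • wilsonW₂ 3 ((8 * (N : ℝ) ^ 2)⁻¹ • wsym22 N) κ u κ' u' + (-(((Lc ^ m : ℕ) : ℝ) ^ 12 / 4)) • symVh₂SAn1 3 (Lc ^ m) κ u κ' u') a 0 e z₀)) μ ν|
        ≤ (289 * S₀ * 300000000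
            * ((16 * ((MG163 4 * periodConst (kappa163 4) 3) * Real.exp (kappa163 4 / 4)) * ((2 * c166Z 3) * Real.exp (kappaZ 3))
                * Real.exp (min (kappa163 4 / 4) (kappaZ 3)) * Real.exp (min (kappa163 4 / 4) (kappaZ 3))
                * Zl 4 (min (kappa163 4 / 4) (kappaZ 3) / 8) * Zl 4 (θ / 2))
              * Real.exp (θ * ((3 : ℝ) + 1))))
          * ∑' x : Site 4, l1 x ^ 2 * Real.exp (-(min (min (kappa163 4 / 4) (kappaZ 3) / 8) (θ / 2)) * l1 x) :=
  row_rest_scales N cΛ hS₀ hK₀ (Cmix := 300000000) (fun m => symMixAbs_ctr4_le (Lc ^ m)) hθ μ ν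


/-- **ROW (rest) ON THE SCALES MODULO THE ff LETTER ALONE** [our objects + folklore]: if the ff block of the straight kernel obeys, for all scales `m`,
`|Γ^{(Lc^m)} κ x l x′| ≤ CΓ·e^{−δΓ|x−x′|₁}` with ONE `CΓ ≥ 0`, `δΓ ≥ 0` (the (K)-wall's letter — DISPLAYED, not asserted), then for the HEAD's pinned (rest) kernel
(i) `∀ m a e, AbsMoment₂ (Wrest m a e)` and (ii) `∀ m, |secondMoment (Wrest m) μ ν| ≤ (289·S₀*·300000000·(K*·e^{4θ}))·Σ'_x |x|₁² e^{−min (m₀∕8) (θ∕2)|x|₁}`,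
`S₀* = CΓ + 2·C₄e^{κ′} + (2·c166Z 3)·e^{kappaZ 3}` — neither `m` nor `Lc` on the right; the leg letter by `StraightPinLegSup.bdd_K₀_scales_of_hΓ`, the table letter by
leaf-04's `symMixAbs_ctr_le`, the multiplier envelope by leaf-04's `abs_wΦ_le_hΦ`.  `Wrest m` is `ChartDefectHeadScales`' pin `hWrest` VERBATIM. -/
theorem row_rest_scales_of_hΓ {Lc : ℕ} [NeZero Lc] (N : ℕ) (cΛ : ℕ → ℝ) {CΓ δΓ : ℝ} (hCΓ : 0 ≤ CΓ) (hδΓ : 0 ≤ δΓ)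
    (hΓ : ∀ (m : ℕ) (κ : Fin (3 + 1)) (x : Site 4) (l : Fin (3 + 1)) (x' : Site 4),
      |Gam (N := Lc ^ m) κ x l x'| ≤ CΓ * Real.exp (-δΓ * l1 (x - x')))
    {θ : ℝ} (hθ : 0 < θ) (μ ν : Fin 4) :
    (∀ (m : ℕ) (a e : Fin 4), AbsMoment₂ (fun z₀ : Site 4 => (1 / 2 : ℝ) * tadpole (coDressKBmAt (ctr 4 (Lc ^ m)) (Lc ^ m) (KInvStep (d := 3) (Lc ^ m) 0))
        (W2SymOfK (KInvStep (d := 3) (Lc ^ m) 0) (Lc ^ m) (fun κ u => (((Lc ^ m : ℕ) : ℝ) ^ 4) • wilsonA 3 κ u + (-(((Lc ^ m : ℕ) : ℝ) ^ 8 / 2)) • symVhSAt (ctr 4 (Lc ^ m)) 3 (Lc ^ m) rfl κ u)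
              ((symTablesAn1S2 3 (Lc ^ m) (cΛ m)).M 0) (fun κ u κ' u' => (((Lc ^ m : ℕ) : ℝ) ^ 8) • wilsonW₂ 3 ((8 * (N : ℝ) ^ 2)⁻¹ • wsym22 N) κ u κ' u' + (-(((Lc ^ m : ℕ) : ℝ) ^ 12 / 4)) • symVh₂SAn1 3 (Lc ^ m) κ u κ' u')
              (M2Of 3 (Lc ^ m) (symTablesAn1S2 3 (Lc ^ m) (cΛ m)).mixFF 0) a 0 e z₀
          - vertex2OfK (KInvStep (d := 3) (Lc ^ m) 0) (Lc ^ m)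
              (fun κ u κ' u' => (((Lc ^ m : ℕ) : ℝ) ^ 8) • wilsonW₂ 3 ((8 * (N : ℝ) ^ 2)⁻¹ • wsym22 N) κ u κ' u' + (-(((Lc ^ m : ℕ) : ℝ) ^ 12 / 4)) • symVh₂SAn1 3 (Lc ^ m) κ u κ' u') a 0 e z₀))) ∧
      ∀ m : ℕ, |secondMoment (fun (a e : Fin 4) (z₀ : Site 4) => (1 / 2 : ℝ) * tadpole (coDressKBmAt (ctr 4 (Lc ^ m)) (Lc ^ m) (KInvStep (d := 3) (Lc ^ m) 0))
        (W2SymOfK (KInvStep (d := 3) (Lc ^ m) 0) (Lc ^ m) (fun κ u => (((Lc ^ m : ℕ) : ℝ) ^ 4) • wilsonA 3 κ u + (-(((Lc ^ m : ℕ) : ℝ) ^ 8 / 2)) • symVhSAt (ctr 4 (Lc ^ m)) 3 (Lc ^ m) rfl κ u)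
              ((symTablesAn1S2 3 (Lc ^ m) (cΛ m)).M 0) (fun κ u κ' u' => (((Lc ^ m : ℕ) : ℝ) ^ 8) • wilsonW₂ 3 ((8 * (N : ℝ) ^ 2)⁻¹ • wsym22 N) κ u κ' u' + (-(((Lc ^ m : ℕ) : ℝ) ^ 12 / 4)) • symVh₂SAn1 3 (Lc ^ m) κ u κ' u')
              (M2Of 3 (Lc ^ m) (symTablesAn1S2 3 (Lc ^ m) (cΛ m)).mixFF 0) a 0 e z₀
          - vertex2OfK (KInvStep (d := 3) (Lc ^ m) 0) (Lc ^ m)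
              (fun κ u κ' u' => (((Lc ^ m : ℕ) : ℝ) ^ 8) • wilsonW₂ 3 ((8 * (N : ℝ) ^ 2)⁻¹ • wsym22 N) κ u κ' u' + (-(((Lc ^ m : ℕ) : ℝ) ^ 12 / 4)) • symVh₂SAn1 3 (Lc ^ m) κ u κ' u') a 0 e z₀)) μ ν|
        ≤ (289 * (CΓ + 2 * ((MG163 4 * periodConst (kappa163 4) 3) * Real.exp (kappa163 4 / 4)) + (2 * c166Z 3) * Real.exp (kappaZ 3)) * 300000000
            * ((16 * ((MG163 4 * periodConst (kappa163 4) 3) * Real.exp (kappa163 4 / 4)) * ((2 * c166Z 3) * Real.exp (kappaZ 3))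
                * Real.exp (min (kappa163 4 / 4) (kappaZ 3)) * Real.exp (min (kappa163 4 / 4) (kappaZ 3))
                * Zl 4 (min (kappa163 4 / 4) (kappaZ 3) / 8) * Zl 4 (θ / 2))
              * Real.exp (θ * ((3 : ℝ) + 1))))
          * ∑' x : Site 4, l1 x ^ 2 * Real.exp (-(min (min (kappa163 4 / 4) (kappaZ 3) / 8) (θ / 2)) * l1 x) :=
  row_rest_scales_free N cΛ (legSupConst_nonneg hCΓ) (bdd_K₀_scales_of_hΓ hCΓ hδΓ hΓ) hθ μ ν

end Summit.QuantumFields.BalabanUV.Beta.D1BFx.ChartDefectRowRestScalesFree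

end
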